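import Summits.PneNP.PneNP.Theses.RootDecompSpaceCeiling
import Literature.Computability.Complexity.Counting
import Literature.Computability.Complexity.CountingProofs
import Literature.Computability.Complexity.OracleEmptyFP
import Literature.Computability.Complexity.BrickAlgebra

/-! # Root decomposition N3 (SpaceCeiling) — exactness of the cycle-2 split at the function level

Closes the aside item stmt-PneNP-32409 `CensusNodeIff` of route `route-PneNP-RootDecompSpaceCeiling`
(cycle-2 node of the decomp-pnenp cell; writer g6 rev 7):
`K_Fn «NP ⊆ P → #P ⊆ FP» ⟺ CensusLiftSqrt ∧ CensusAmplifySqrt`, hypothesis-free.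

Port of lens-3 g10 `node_iff` at budget `√m` / writer certificate `N3C2_items-g6.lean`
(`censusNodeIff_holds`): (→) under `#P ⊆ FP` the decoder computes the census itself with EMPTY
advice (`encodeNat ∘ #_R^p ∘ Brick.fstF ∈ FP`); (←) modus ponens. Standard axioms only.
-/

namespace Summit.PneNP.PneNP.Theorems

open Literature.Computability.Complexity

/-- FLOOR ⟹ every census cell with EMPTY advice: if `#P ⊆ FP` the decoder computes the census itself
(budget function `b` arbitrary). -/
private theorem censusCell_of_sharpP_easy (b : ℕ → ℕ)
    (h : ∀ f ∈ SharpP, (Computability.encodeNat ∘ f) ∈ FP) :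
    ∀ R ∈ Classes.P, ∀ p : Polynomial ℕ, ∃ D ∈ FP, ∃ c : ℕ, ∀ x : List Bool, ∃ i : List Bool,
      i.length ≤ c * b (p.eval x.length) + c ∧
      D (boolPair x i) = Computability.encodeNat (countWitnesses R (p.eval x.length) x) := by
  intro R hR p
  have hfS : (fun x => countWitnesses R (p.eval x.length) x) ∈ SharpP := ⟨R, hR, p, fun _ => rfl⟩
  refine ⟨(Computability.encodeNat ∘ fun x => countWitnesses R (p.eval x.length) x) ∘ Brick.fstF,
    comp_mem_FP (h _ hfS) Brick.fstF_mem_FP, 0, fun x => ⟨[], by simp, ?_⟩⟩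
  simp [Brick.fstF_boolPair]

/-- EXACTNESS of the cycle-2 split of `K = CollapseLift` (stmt-PneNP-23703) at the function level:
`(NP ⊆ P → #P ⊆ FP) ↔ (CensusLiftSqrt ∧ CensusAmplifySqrt)`, hypothesis-free. Closes stmt-PneNP-32409. -/
theorem censusNodeIff_proof :
    Summit.PneNP.PneNP.Theses.RootDecompSpaceCeiling.CensusNodeIff := by
  unfold Summit.PneNP.PneNP.Theses.RootDecompSpaceCeiling.CensusNodeIff
    Summit.PneNP.PneNP.Theses.RootDecompSpaceCeiling.CensusAmplifySqrt
    Summit.PneNP.PneNP.Theses.RootDecompSpaceCeiling.CensusLiftSqrt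
  refine ⟨fun h => ⟨fun hNP => censusCell_of_sharpP_easy (fun m => Nat.sqrt m) (h hNP),
    fun _ => h⟩, fun h => h.2 h.1⟩

end Summit.PneNP.PneNP.Theorems
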